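import Mathlib
import Summits.NavierStokesRegularity.NavierStokesRegularity.Theorems.L3TimeExponentPincerMorreyInterpolation
import HarnessLib.Audit
import HarnessLib

/-!
# The slice inequality with the Morrey bound at SMALL radii only
# (route `L3TimeExponentPincer`, crux `L3CascadeJaw` stmt-NavierStokesRegularity-19499; support file 9 of seat
# p4 — pure analysis, the restricted-radius form of `L3TimeExponentPincerMorreyInterpolation`)

Support file (cell ns-regularity-ideate, seat p4, gen 5).  0 `sorry`, no definitions.

`L3TimeExponentPincerMorreyInterpolation.lintegral_cube_sq_le_of_morrey` (nsreg-p4 g4) bounds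
`(∫|f|³)² ≤ (576 M₂/V₁) ‖f‖₂² ‖∇f‖₂²` for `C¹` fields `f` on `ℝ³` whose closed-ball energies satisfy the Morrey
bound `∫_{B̄(x₀,ρ)}|f|² ≤ M₂ ρ` at ALL centres and ALL radii.  Reading its layer-cake proof shows that the
Morrey bound at level `l` is used only at the single radius `ρ(l) = 2√(M₂/V₁)/l`, which is SMALL for LARGE
levels.  This file records the consequence: if the Morrey bound is known only for radii `ρ ≤ ρ⋆`, the high
levels `l ≥ l⋆ := 2√(M₂/V₁)/ρ⋆` are treated exactly as before and the low levels by the plain energy Chebyshev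
bound, giving

  `(∫|f|³)² ≤ (576 M₂/V₁) ‖f‖₂² ‖∇f‖₂² + (144 M₂/(V₁ ρ⋆²)) (‖f‖₂²)²`

(`lintegral_cube_sq_le_of_morreyBelow`).  The second term is the price of the missing large radii; it involves
neither the gradient nor any information at scales `> ρ⋆`.

* `norm_ballAvg_sq_le_at`, `meas_gt_mul_le_of_morreyAt` — the pointwise ball-average bound and the
  Chebyshev-after-splitting bound with the Morrey hypothesis at ONE radius (proofs adapted verbatim from
  `norm_ballAvg_sq_le` / `meas_gt_mul_le_of_morrey`);
* `lintegral_cube_le_split_of_le` — the two-parameter bound `∫|f|³ ≤ 3(‖f‖₂² Λ + (16M₂/V₁)‖∇f‖₂² Λ⁻¹)` for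
  every split level `Λ ≥ l⋆`, from the Morrey bound at radii `≤ ρ⋆` (adapted from `lintegral_cube_le_split`);
* `sq_le_of_forall_ge_le_linear_add_inv` — optimisation under the constraint `Λ ≥ l⋆`:
  `X ≤ aΛ + bΛ⁻¹ (∀ Λ ≥ l⋆) ⇒ X² ≤ 4ab + 4a² l⋆²`;
* `lintegral_cube_sq_le_of_morreyBelow` — the restricted-radius slice inequality above.

Used by support file 10 (`L3TimeExponentPincerSubparabolicMorreyJaw`): for a frame solution the Morrey bound at
SUB-PARABOLIC radii `r ≤ √(T-t)` alone gives `‖u(t)‖₃⁶ ≤ C₁ ∫|∇u(t)|² + C₂/(T-t)`, hence `u ∈ L^q_t L³_x` for every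
`q < 6` — THEOREM J′ needed the bound at all radii `< r₁` only for the endpoint `q = 6`.
WHAT THIS IS NOT: not a claim about Navier–Stokes; no item is closed.
-/

noncomputable section

namespace Summit.NavierStokesRegularity.NavierStokesRegularity.Theorems.L3TimeExponentPincerMorreyInterpolationBelow

open MeasureTheory Set Function Filter Metric Topology
open scoped ENNReal NNReal
open Summit.NavierStokesRegularity.NavierStokesRegularity.Theorems.L3TimeExponentPincerMorreyGrowth (V₁ V₁_nonneg volume_ball_eq)
open Summit.NavierStokesRegularity.NavierStokesRegularity.Theorems.L3TimeExponentPincerBallAverage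
open Summit.NavierStokesRegularity.NavierStokesRegularity.Theorems.L3TimeExponentPincerMorreyInterpolation
  (meas_gt_mul_le_energy lintegral_cube_eq_layerCake)

/-! ### §1  One radius at a time -/

/-- **Ball-average bound from the Morrey bound at ONE radius**: if `∫_{B̄(x₀,ρ)} |f|² ≤ M₂ ρ` for all centres
`x₀` at the fixed radius `ρ`, then `‖A_ρ f(x)‖² ≤ M₂/(V₁ ρ²)` (adapted from `norm_ballAvg_sq_le`). -/
theorem norm_ballAvg_sq_le_at {f : (EuclideanSpace ℝ (Fin 3)) → (EuclideanSpace ℝ (Fin 3))} (hf : Continuous f)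
    {M₂ : ℝ} (hM₂ : 0 ≤ M₂) {ρ : ℝ} (hρ : 0 < ρ)
    (hMor : ∀ x₀ : EuclideanSpace ℝ (Fin 3), ∫⁻ y in closedBall x₀ ρ, ‖f y‖ₑ ^ 2 ≤ ENNReal.ofReal (M₂ * ρ))
    (x : EuclideanSpace ℝ (Fin 3)) :
    ‖(volume (closedBall (0 : EuclideanSpace ℝ (Fin 3)) ρ)).toReal⁻¹ •
        ∫ z in closedBall (0 : EuclideanSpace ℝ (Fin 3)) ρ, f (x + z)‖ ^ 2 ≤ M₂ / (V₁ * ρ ^ 2) := by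
  -- adapted from Theorems/L3TimeExponentPincerMorreyInterpolation.lean `norm_ballAvg_sq_le` (nsreg-p4 g4)
  have hV : 0 < V₁ := by
    rw [V₁]
    exact ENNReal.toReal_pos (measure_ball_pos volume (0 : EuclideanSpace ℝ (Fin 3)) one_pos).ne'
      measure_ball_lt_top.ne
  have h := enorm_ballAvg_sq_le hf x hρ
  have h2 : ‖(volume (closedBall (0 : EuclideanSpace ℝ (Fin 3)) ρ)).toReal⁻¹ •
      ∫ z in closedBall (0 : EuclideanSpace ℝ (Fin 3)) ρ, f (x + z)‖ₑ ^ 2 ≤ ENNReal.ofReal (M₂ / (V₁ * ρ ^ 2)) := by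
    refine h.trans ?_
    rw [volume_closedBall_eq 0 hρ]
    calc (ENNReal.ofReal (ρ ^ 3 * V₁))⁻¹ * ∫⁻ y in closedBall x ρ, ‖f y‖ₑ ^ 2
        ≤ (ENNReal.ofReal (ρ ^ 3 * V₁))⁻¹ * ENNReal.ofReal (M₂ * ρ) := by gcongr; exact hMor x
      _ = ENNReal.ofReal (M₂ / (V₁ * ρ ^ 2)) := by
          rw [← ENNReal.ofReal_inv_of_pos (by positivity), ← ENNReal.ofReal_mul (by positivity)]
          congr 1
          field_simp
  rw [← ofReal_norm, ← ENNReal.ofReal_pow (norm_nonneg _)] at h2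
  exact (ENNReal.ofReal_le_ofReal_iff (by positivity)).1 h2

/-- **Chebyshev at level `l` after splitting off the average**, with the Morrey bound at the single radius
`ρ = 2√(M₂/V₁)/l`: `|{‖f‖ > l}| · (l/2)² ≤ ρ² ‖∇f‖₂²` (adapted from `meas_gt_mul_le_of_morrey`). -/
theorem meas_gt_mul_le_of_morreyAt {f : (EuclideanSpace ℝ (Fin 3)) → (EuclideanSpace ℝ (Fin 3))}
    (hf : ContDiff ℝ 1 f) {M₂ : ℝ} (hM₂ : 0 < M₂) {l : ℝ} (hl : 0 < l)
    (hMor : ∀ x₀ : EuclideanSpace ℝ (Fin 3),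
      ∫⁻ y in closedBall x₀ (2 * Real.sqrt (M₂ / V₁) / l), ‖f y‖ₑ ^ 2 ≤
        ENNReal.ofReal (M₂ * (2 * Real.sqrt (M₂ / V₁) / l))) :
    volume {x | l < ‖f x‖} * ENNReal.ofReal ((l / 2) ^ 2) ≤
      ENNReal.ofReal ((2 * Real.sqrt (M₂ / V₁) / l) ^ 2) * ∫⁻ x, ‖fderiv ℝ f x‖ₑ ^ 2 := by
  -- adapted from Theorems/L3TimeExponentPincerMorreyInterpolation.lean `meas_gt_mul_le_of_morrey` (nsreg-p4 g4)
  have hV : 0 < V₁ := by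
    rw [V₁]
    exact ENNReal.toReal_pos (measure_ball_pos volume (0 : EuclideanSpace ℝ (Fin 3)) one_pos).ne'
      measure_ball_lt_top.ne
  have hfc : Continuous f := hf.continuous
  set ρ : ℝ := 2 * Real.sqrt (M₂ / V₁) / l with hρdef
  have hρ : 0 < ρ := by positivity
  set K : Set (EuclideanSpace ℝ (Fin 3)) := closedBall 0 ρ with hK
  set A : (EuclideanSpace ℝ (Fin 3)) → (EuclideanSpace ℝ (Fin 3)) :=
    fun x => (volume K).toReal⁻¹ • ∫ z in K, f (x + z) with hA
  have hAc : Continuous A := by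
    have h1 : Continuous (uncurry fun (x z : EuclideanSpace ℝ (Fin 3)) => f (x + z)) :=
      hfc.comp (continuous_fst.add continuous_snd)
    exact (continuous_parametric_integral_of_continuous (μ := volume) h1 (isCompact_closedBall _ _)).const_smul
      ((volume K).toReal⁻¹ : ℝ)
  have hρsq : M₂ / (V₁ * ρ ^ 2) = (l / 2) ^ 2 := by
    rw [hρdef, div_pow, mul_pow, Real.sq_sqrt (by positivity)]
    field_simp
  have hlow : ∀ x, ‖A x‖ ≤ l / 2 := by
    intro x
    have h := norm_ballAvg_sq_le_at hfc hM₂.le hρ hMor x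
    rw [hρsq] at h
    exact (pow_le_pow_iff_left₀ (norm_nonneg _) (by positivity) two_ne_zero).1 h
  have hsub : {x | l < ‖f x‖} ⊆ {x | ENNReal.ofReal ((l / 2) ^ 2) ≤ ‖f x - A x‖ₑ ^ 2} := by
    intro x hx
    simp only [mem_setOf_eq] at hx ⊢
    have h1 : l / 2 ≤ ‖f x - A x‖ := by
      have h2 : ‖f x‖ - ‖A x‖ ≤ ‖f x - A x‖ := by
        have := norm_le_norm_add_norm_sub' (f x) (A x)
        linarith
      linarith [hlow x]
    rw [← ofReal_norm, ← ENNReal.ofReal_pow (norm_nonneg _)]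
    exact ENNReal.ofReal_le_ofReal (pow_le_pow_left₀ (by positivity) h1 2)
  have hmeas : AEMeasurable (fun x => ‖f x - A x‖ₑ ^ 2) volume :=
    ((hfc.sub hAc).measurable.enorm.pow_const 2).aemeasurable
  calc volume {x | l < ‖f x‖} * ENNReal.ofReal ((l / 2) ^ 2)
      ≤ volume {x | ENNReal.ofReal ((l / 2) ^ 2) ≤ ‖f x - A x‖ₑ ^ 2} * ENNReal.ofReal ((l / 2) ^ 2) := by
        gcongr
    _ = ENNReal.ofReal ((l / 2) ^ 2) * volume {x | ENNReal.ofReal ((l / 2) ^ 2) ≤ ‖f x - A x‖ₑ ^ 2} :=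
        mul_comm _ _
    _ ≤ ∫⁻ x, ‖f x - A x‖ₑ ^ 2 := mul_meas_ge_le_lintegral₀ hmeas _
    _ ≤ ENNReal.ofReal (ρ ^ 2) * ∫⁻ x, ‖fderiv ℝ f x‖ₑ ^ 2 := lintegral_enorm_sub_ballAvg_sq_le hf hρ

/-! ### §2  The two-parameter bound for split levels above `l⋆ = 2√(M₂/V₁)/ρ⋆` -/

/-- **Two-parameter bound from the Morrey bound at radii `≤ ρ⋆`**: for every split level
`Λ ≥ 2√(M₂/V₁)/ρ⋆`, `∫|f|³ ≤ 3(‖f‖₂² Λ + (16 M₂/V₁) ‖∇f‖₂² Λ⁻¹)` (levels above `Λ` only need radii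
`2√(M₂/V₁)/l ≤ ρ⋆`; adapted from `lintegral_cube_le_split`). -/
theorem lintegral_cube_le_split_of_le {f : (EuclideanSpace ℝ (Fin 3)) → (EuclideanSpace ℝ (Fin 3))}
    (hf : ContDiff ℝ 1 f) {M₂ : ℝ} (hM₂ : 0 < M₂) {ρs : ℝ} (hρs : 0 < ρs)
    (hMor : ∀ (x₀ : EuclideanSpace ℝ (Fin 3)) (ρ : ℝ), 0 < ρ → ρ ≤ ρs →
      ∫⁻ y in closedBall x₀ ρ, ‖f y‖ₑ ^ 2 ≤ ENNReal.ofReal (M₂ * ρ))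
    {Λ : ℝ} (hΛ : 2 * Real.sqrt (M₂ / V₁) / ρs ≤ Λ) :
    ∫⁻ x, ‖f x‖ₑ ^ (3 : ℕ) ≤
      (3 * ∫⁻ x, ‖f x‖ₑ ^ 2) * ENNReal.ofReal Λ +
        (3 * (ENNReal.ofReal (16 * M₂ / V₁) * ∫⁻ x, ‖fderiv ℝ f x‖ₑ ^ 2)) * ENNReal.ofReal Λ⁻¹ := by
  -- adapted from Theorems/L3TimeExponentPincerMorreyInterpolation.lean `lintegral_cube_le_split` (nsreg-p4 g4)
  have hV : 0 < V₁ := by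
    rw [V₁]
    exact ENNReal.toReal_pos (measure_ball_pos volume (0 : EuclideanSpace ℝ (Fin 3)) one_pos).ne'
      measure_ball_lt_top.ne
  have hls : 0 < 2 * Real.sqrt (M₂ / V₁) / ρs := by positivity
  have hΛ0 : 0 < Λ := lt_of_lt_of_le hls hΛ
  have hfc : Continuous f := hf.continuous
  set e : ℝ≥0∞ := ∫⁻ x, ‖f x‖ₑ ^ 2 with he
  set D : ℝ≥0∞ := ∫⁻ x, ‖fderiv ℝ f x‖ₑ ^ 2 with hD
  set G : ℝ → ℝ≥0∞ := fun t => volume {x | t < ‖f x‖} * ENNReal.ofReal (t ^ 2) with hG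
  have hsmall : ∀ t ∈ Ioc (0 : ℝ) Λ, G t ≤ e := fun t ht => meas_gt_mul_le_energy hfc ht.1
  have hlarge : ∀ t ∈ Ioi Λ, G t ≤ (ENNReal.ofReal (16 * M₂ / V₁) * D) * ENNReal.ofReal (t ^ (-2 : ℝ)) := by
    intro t ht
    have ht0 : 0 < t := hΛ0.trans ht
    -- the radius `2√(M₂/V₁)/t` is `≤ ρs` since `t > Λ ≥ 2√(M₂/V₁)/ρs`
    have hρle : 2 * Real.sqrt (M₂ / V₁) / t ≤ ρs := by
      rw [div_le_iff₀ ht0]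
      have h1 : 2 * Real.sqrt (M₂ / V₁) ≤ Λ * ρs := (div_le_iff₀ hρs).1 hΛ
      have h2 : Λ * ρs ≤ t * ρs := mul_le_mul_of_nonneg_right (le_of_lt ht) hρs.le
      linarith [mul_comm ρs t]
    have h1 := meas_gt_mul_le_of_morreyAt hf hM₂ ht0 (fun x₀ => hMor x₀ _ (by positivity) hρle)
    have hρ2 : (2 * Real.sqrt (M₂ / V₁) / t) ^ 2 = 4 * (M₂ / V₁) / t ^ 2 := by
      rw [div_pow, mul_pow, Real.sq_sqrt (by positivity)]
      ring
    rw [hρ2] at h1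
    have ht2 : ENNReal.ofReal (t ^ 2) = ENNReal.ofReal ((t / 2) ^ 2) * ENNReal.ofReal 4 := by
      rw [← ENNReal.ofReal_mul (by positivity)]
      congr 1
      ring
    calc G t = volume {x | t < ‖f x‖} * ENNReal.ofReal ((t / 2) ^ 2) * ENNReal.ofReal 4 := by
          rw [hG]
          simp only
          rw [ht2, mul_assoc]
      _ ≤ ENNReal.ofReal (4 * (M₂ / V₁) / t ^ 2) * D * ENNReal.ofReal 4 := by gcongr
      _ = (ENNReal.ofReal (16 * M₂ / V₁) * D) * ENNReal.ofReal (t ^ (-2 : ℝ)) := by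
          rw [mul_assoc, mul_comm D, ← mul_assoc, ← ENNReal.ofReal_mul (by positivity),
            mul_assoc, mul_comm D, ← mul_assoc, ← ENNReal.ofReal_mul (by positivity)]
          congr 2
          rw [Real.rpow_neg ht0.le, Real.rpow_two]
          field_simp
          ring
  have htail : ∫⁻ t in Ioi Λ, ENNReal.ofReal (t ^ (-2 : ℝ)) = ENNReal.ofReal Λ⁻¹ := by
    rw [← ofReal_integral_eq_lintegral_ofReal (integrableOn_Ioi_rpow_of_lt (by norm_num) hΛ0)]
    · rw [integral_Ioi_rpow_of_lt (by norm_num) hΛ0]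
      congr 1
      norm_num
      rw [Real.rpow_neg_one]
    · exact (ae_restrict_iff' measurableSet_Ioi).2 (Eventually.of_forall fun t ht =>
        Real.rpow_nonneg (hΛ0.trans ht).le _)
  rw [lintegral_cube_eq_layerCake hfc, ← Ioc_union_Ioi_eq_Ioi hΛ0.le,
    lintegral_union measurableSet_Ioi Ioc_disjoint_Ioi_same]
  have hI1 : ∫⁻ t in Ioc (0 : ℝ) Λ, G t ≤ e * ENNReal.ofReal Λ := by
    calc ∫⁻ t in Ioc (0 : ℝ) Λ, G t ≤ ∫⁻ t in Ioc (0 : ℝ) Λ, e := setLIntegral_mono' measurableSet_Ioc hsmall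
      _ = e * ENNReal.ofReal Λ := by rw [setLIntegral_const, Real.volume_Ioc, sub_zero]
  have hI2 : ∫⁻ t in Ioi Λ, G t ≤ (ENNReal.ofReal (16 * M₂ / V₁) * D) * ENNReal.ofReal Λ⁻¹ := by
    calc ∫⁻ t in Ioi Λ, G t
        ≤ ∫⁻ t in Ioi Λ, (ENNReal.ofReal (16 * M₂ / V₁) * D) * ENNReal.ofReal (t ^ (-2 : ℝ)) :=
          setLIntegral_mono' measurableSet_Ioi hlarge
      _ = (ENNReal.ofReal (16 * M₂ / V₁) * D) * ∫⁻ t in Ioi Λ, ENNReal.ofReal (t ^ (-2 : ℝ)) := by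
          rw [lintegral_const_mul]
          exact (measurable_id.pow_const _).ennreal_ofReal
      _ = (ENNReal.ofReal (16 * M₂ / V₁) * D) * ENNReal.ofReal Λ⁻¹ := by rw [htail]
  have h3 : ENNReal.ofReal 3 = 3 := by norm_num
  show ENNReal.ofReal 3 * ((∫⁻ t in Ioc (0 : ℝ) Λ, G t) + ∫⁻ t in Ioi Λ, G t) ≤ _
  calc ENNReal.ofReal 3 * ((∫⁻ t in Ioc (0 : ℝ) Λ, G t) + ∫⁻ t in Ioi Λ, G t)
      ≤ ENNReal.ofReal 3 * (e * ENNReal.ofReal Λ + (ENNReal.ofReal (16 * M₂ / V₁) * D) * ENNReal.ofReal Λ⁻¹) := by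
        gcongr
    _ = (3 * e) * ENNReal.ofReal Λ + (3 * (ENNReal.ofReal (16 * M₂ / V₁) * D)) * ENNReal.ofReal Λ⁻¹ := by
        rw [h3]
        ring

/-! ### §3  Optimising the split level under the constraint `Λ ≥ l⋆` -/

/-- **Constrained optimisation**: if `X ≤ a Λ + b Λ⁻¹` for every `Λ ≥ l⋆ > 0` (`a, b` finite), then
`X² ≤ 4 a b + 4 a² l⋆²` (take `Λ = √(b/a)` when it is admissible, else `Λ = l⋆`). -/
theorem sq_le_of_forall_ge_le_linear_add_inv {X a b : ℝ≥0∞} (ha : a ≠ ⊤) (hb : b ≠ ⊤) {ls : ℝ} (hls : 0 < ls)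
    (h : ∀ Λ : ℝ, ls ≤ Λ → X ≤ a * ENNReal.ofReal Λ + b * ENNReal.ofReal Λ⁻¹) :
    X ^ 2 ≤ 4 * a * b + 4 * a ^ 2 * ENNReal.ofReal (ls ^ 2) := by
  by_cases hcase : b ≤ a * ENNReal.ofReal (ls ^ 2)
  · -- `Λ = l⋆`: `X ≤ a l⋆ + b/l⋆ ≤ 2 a l⋆`
    have h1 : X ≤ 2 * (a * ENNReal.ofReal ls) := by
      calc X ≤ a * ENNReal.ofReal ls + b * ENNReal.ofReal ls⁻¹ := h ls le_rfl
        _ ≤ a * ENNReal.ofReal ls + a * ENNReal.ofReal (ls ^ 2) * ENNReal.ofReal ls⁻¹ := by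
            gcongr
        _ = a * ENNReal.ofReal ls + a * ENNReal.ofReal ls := by
            rw [mul_assoc, ← ENNReal.ofReal_mul (by positivity)]
            congr 2
            field_simp
        _ = 2 * (a * ENNReal.ofReal ls) := by rw [two_mul]
    calc X ^ 2 ≤ (2 * (a * ENNReal.ofReal ls)) ^ 2 := pow_le_pow_left' h1 2
      _ = 4 * a ^ 2 * ENNReal.ofReal (ls ^ 2) := by
          rw [ENNReal.ofReal_pow hls.le]
          ring
      _ ≤ 4 * a * b + 4 * a ^ 2 * ENNReal.ofReal (ls ^ 2) := le_add_self
  · rw [not_le] at hcase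
    rcases eq_or_ne a 0 with rfl | ha0
    · -- `X ≤ b / Λ` for all `Λ ≥ l⋆`: `X = 0`
      have hX : X ≤ 0 := by
        refine ENNReal.le_of_forall_pos_le_add fun ε hε _ => ?_
        have hε' : (0 : ℝ) < ε := hε
        have hΛ : ls ≤ b.toReal / ε + ls := le_add_of_nonneg_left (by positivity)
        have hΛpos : 0 < b.toReal / ε + ls := by positivity
        calc X ≤ 0 * ENNReal.ofReal (b.toReal / ε + ls) + b * ENNReal.ofReal (b.toReal / ε + ls)⁻¹ := h _ hΛ
          _ = ENNReal.ofReal (b.toReal * (b.toReal / ε + ls)⁻¹) := by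
              rw [zero_mul, zero_add, ENNReal.ofReal_mul ENNReal.toReal_nonneg, ENNReal.ofReal_toReal hb]
          _ ≤ ENNReal.ofReal ε := by
              refine ENNReal.ofReal_le_ofReal ?_
              rw [← div_eq_mul_inv, div_le_iff₀ hΛpos]
              nlinarith [ENNReal.toReal_nonneg (a := b), mul_div_cancel₀ b.toReal hε'.ne']
          _ = 0 + ε := by rw [ENNReal.ofReal_coe_nnreal, zero_add]
      have hX0 : X = 0 := le_antisymm hX bot_le
      rw [hX0]
      simp
    -- main case: `0 < a < ⊤`, `a l⋆² < b < ⊤`; take `Λ = √(b/a) ≥ l⋆`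
    set α : ℝ := a.toReal with hα
    set β : ℝ := b.toReal with hβ
    have hαpos : 0 < α := ENNReal.toReal_pos ha0 ha
    have hαβ : α * ls ^ 2 < β := by
      have h1 : (a * ENNReal.ofReal (ls ^ 2)).toReal < b.toReal :=
        (ENNReal.toReal_lt_toReal (ENNReal.mul_ne_top ha ENNReal.ofReal_ne_top) hb).2 hcase
      rwa [ENNReal.toReal_mul, ENNReal.toReal_ofReal (sq_nonneg _)] at h1
    have hβpos : 0 < β := lt_of_le_of_lt (by positivity) hαβ
    have hb0 : b ≠ 0 := fun h0 => by rw [hβ, h0, ENNReal.toReal_zero] at hβpos; exact lt_irrefl _ hβpos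
    set Λ : ℝ := Real.sqrt (β / α) with hΛdef
    have hΛ : 0 < Λ := Real.sqrt_pos.2 (div_pos hβpos hαpos)
    have hΛsq : Λ ^ 2 = β / α := Real.sq_sqrt (div_pos hβpos hαpos).le
    have hΛls : ls ≤ Λ := by
      have h1 : ls ^ 2 ≤ Λ ^ 2 := by
        rw [hΛsq, le_div_iff₀ hαpos]
        nlinarith
      exact (pow_le_pow_iff_left₀ hls.le hΛ.le two_ne_zero).1 h1
    have h1 : α * Λ = Real.sqrt (α * β) := by
      rw [hΛdef, ← Real.sqrt_sq hαpos.le, ← Real.sqrt_mul (sq_nonneg α), Real.sqrt_sq hαpos.le]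
      congr 1
      field_simp
    have h2 : β * Λ⁻¹ = Real.sqrt (α * β) := by
      have hΛne : Λ ≠ 0 := hΛ.ne'
      have hβ' : β = α * Λ ^ 2 := by rw [hΛsq]; field_simp
      calc β * Λ⁻¹ = α * Λ ^ 2 * Λ⁻¹ := by rw [hβ']
        _ = α * Λ := by field_simp
        _ = Real.sqrt (α * β) := h1
    have hX : X ≤ ENNReal.ofReal (2 * Real.sqrt (α * β)) := by
      calc X ≤ a * ENNReal.ofReal Λ + b * ENNReal.ofReal Λ⁻¹ := h Λ hΛls
        _ = ENNReal.ofReal (α * Λ) + ENNReal.ofReal (β * Λ⁻¹) := by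
            rw [← ENNReal.ofReal_toReal ha, ← ENNReal.ofReal_toReal hb, ← hα, ← hβ,
              ← ENNReal.ofReal_mul hαpos.le, ← ENNReal.ofReal_mul hβpos.le]
        _ = ENNReal.ofReal (2 * Real.sqrt (α * β)) := by
            rw [h1, h2, ← ENNReal.ofReal_add (Real.sqrt_nonneg _) (Real.sqrt_nonneg _), two_mul]
    calc X ^ 2 ≤ (ENNReal.ofReal (2 * Real.sqrt (α * β))) ^ 2 := pow_le_pow_left' hX 2
      _ = ENNReal.ofReal (4 * α * β) := by
          rw [← ENNReal.ofReal_pow (by positivity)]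
          congr 1
          rw [mul_pow, Real.sq_sqrt (by positivity)]
          ring
      _ = 4 * a * b := by
          rw [ENNReal.ofReal_mul (by positivity), ENNReal.ofReal_mul (by positivity), hα, hβ,
            ENNReal.ofReal_toReal ha, ENNReal.ofReal_toReal hb]
          norm_num
      _ ≤ 4 * a * b + 4 * a ^ 2 * ENNReal.ofReal (ls ^ 2) := le_self_add

/-! ### §4  The restricted-radius slice inequality -/

/-- **THE SLICE INEQUALITY WITH THE MORREY BOUND AT SMALL RADII ONLY**: for a `C¹` field on `ℝ³` with
`∫_{B̄(x₀,ρ)} |f|² ≤ M₂ ρ` for all centres and all radii `0 < ρ ≤ ρ⋆`, and `‖f‖₂ < ∞`,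
`(∫ |f|³)² ≤ (576 M₂/V₁) ‖f‖₂² ‖∇f‖₂² + (144 M₂/(V₁ ρ⋆²)) (‖f‖₂²)²`.
The first term is the unrestricted bound of `lintegral_cube_sq_le_of_morrey`; the second is the price of the
missing radii `> ρ⋆` (energy Chebyshev below the level `2√(M₂/V₁)/ρ⋆`). -/
theorem lintegral_cube_sq_le_of_morreyBelow {f : (EuclideanSpace ℝ (Fin 3)) → (EuclideanSpace ℝ (Fin 3))}
    (hf : ContDiff ℝ 1 f) {M₂ : ℝ} (hM₂ : 0 < M₂) {ρs : ℝ} (hρs : 0 < ρs)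
    (hMor : ∀ (x₀ : EuclideanSpace ℝ (Fin 3)) (ρ : ℝ), 0 < ρ → ρ ≤ ρs →
      ∫⁻ y in closedBall x₀ ρ, ‖f y‖ₑ ^ 2 ≤ ENNReal.ofReal (M₂ * ρ))
    (he : ∫⁻ x, ‖f x‖ₑ ^ 2 ≠ ⊤) :
    (∫⁻ x, ‖f x‖ₑ ^ (3 : ℕ)) ^ 2 ≤
      ENNReal.ofReal (576 * M₂ / V₁) * (∫⁻ x, ‖f x‖ₑ ^ 2) * (∫⁻ x, ‖fderiv ℝ f x‖ₑ ^ 2) +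
        ENNReal.ofReal (144 * M₂ / (V₁ * ρs ^ 2)) * (∫⁻ x, ‖f x‖ₑ ^ 2) ^ 2 := by
  have hV : 0 < V₁ := by
    rw [V₁]
    exact ENNReal.toReal_pos (measure_ball_pos volume (0 : EuclideanSpace ℝ (Fin 3)) one_pos).ne'
      measure_ball_lt_top.ne
  have hfc : Continuous f := hf.continuous
  set e : ℝ≥0∞ := ∫⁻ x, ‖f x‖ₑ ^ 2 with hedef
  set D : ℝ≥0∞ := ∫⁻ x, ‖fderiv ℝ f x‖ₑ ^ 2 with hDdef
  set ls : ℝ := 2 * Real.sqrt (M₂ / V₁) / ρs with hlsdef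
  have hls : 0 < ls := by positivity
  rcases eq_or_ne D ⊤ with hDtop | hDtop
  · rcases eq_or_ne e 0 with he0 | he0
    · -- `f = 0` a.e.
      have hae : ∀ᵐ x ∂volume, ‖f x‖ₑ ^ 2 = 0 :=
        (lintegral_eq_zero_iff' ((hfc.measurable.enorm.pow_const 2).aemeasurable)).1 he0
      have h0 : ∫⁻ x, ‖f x‖ₑ ^ (3 : ℕ) = 0 := by
        refine (lintegral_eq_zero_iff' ((hfc.measurable.enorm.pow_const 3).aemeasurable)).2 ?_
        filter_upwards [hae] with x hx
        simp only [Pi.zero_apply, pow_eq_zero_iff, ne_eq, OfNat.ofNat_ne_zero, not_false_eq_true] at hx ⊢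
        exact hx
      rw [h0]
      simp
    · rw [hDtop, ENNReal.mul_top]
      · rw [top_add]; exact le_top
      · exact mul_ne_zero (by simp [ENNReal.ofReal_eq_zero, not_le]; positivity) he0
  have ha : 3 * e ≠ ⊤ := ENNReal.mul_ne_top (by norm_num) he
  have hb : 3 * (ENNReal.ofReal (16 * M₂ / V₁) * D) ≠ ⊤ :=
    ENNReal.mul_ne_top (by norm_num) (ENNReal.mul_ne_top ENNReal.ofReal_ne_top hDtop)
  have h := sq_le_of_forall_ge_le_linear_add_inv ha hb hls
    fun Λ hΛ => lintegral_cube_le_split_of_le hf hM₂ hρs hMor hΛ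
  refine h.trans (le_of_eq ?_)
  have h576 : ENNReal.ofReal (576 * M₂ / V₁) = 36 * ENNReal.ofReal (16 * M₂ / V₁) := by
    rw [show (36 : ℝ≥0∞) = ENNReal.ofReal 36 by norm_num, ← ENNReal.ofReal_mul (by norm_num)]
    congr 1
    ring
  have h144 : ENNReal.ofReal (144 * M₂ / (V₁ * ρs ^ 2)) = 36 * ENNReal.ofReal (ls ^ 2) := by
    rw [show (36 : ℝ≥0∞) = ENNReal.ofReal 36 by norm_num, ← ENNReal.ofReal_mul (by norm_num), hlsdef,
      div_pow, mul_pow, Real.sq_sqrt (by positivity)]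
    congr 1
    field_simp
    ring
  rw [h576, h144]
  ring

end Summit.NavierStokesRegularity.NavierStokesRegularity.Theorems.L3TimeExponentPincerMorreyInterpolationBelow

end
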